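import Mathlib
import Literature.MathematicalPhysics.QuantumFieldTheory.Balaban1983to89.B9Eq325Proj
import Literature.MathematicalPhysics.QuantumFieldTheory.Balaban1983to89.B9Thm311Lattice

/-!
# `Balaban1983to89.B8Eq127LandauGauge` — T. Bałaban, *Spaces of regular gauge field configurations on a lattice and
# gauge fixing conditions*, Commun. Math. Phys. **99** (1985) 75–102 [Balaban1985RegularSpaces]: the Landau gauge
# condition relative to a background field `U₀`, (1.27) «R(U₀)D^{η*}_{U₀}(1/i) log U′ = 0», and its companions (1.38),
# (1.42), (1.138), (1.146), TYPED CONCRETELY (variational form) and identified with the printed orthogonal projection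

statement-level skeleton of published theorems with citation tags; proofs where landed; nothing here is a claim about the Yang–Mills mass gap

PDF held: `paper:balaban1985-cmp99-regular-spaces-gauge-fixing` (journal page = PDF page + 74).  Pages read for this
module AS IMAGES: render `run/shared/lean/pub/pub-balaban/b2b-balaban-ref1/pages/1985-cmp99-regular-spaces-gauge-fixing/
…-p006-x4.png` (p. 80); pp. 82, 83, 99, 101 from the cell's earlier reads (rows B8.Eq1.36, B8.Eq1.40, B8.Prop6, B8.Thm8 of
`run/shared/lean/pub/lit-balaban/lit-balaban-r05/ROWS-B8.md`); [4] = Bałaban, CMP **99** (1985) 389–434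
[Balaban1985BackgroundPropagators] pp. 393–394, (3.19)–(3.25), through the tree modules `B9Eq325Proj`, `B9Thm311Lattice`.

CITATION HEADER (lean-in-tree rule).  Cell `lit-balaban`, unit `lit-balaban-r05` gen 4 (B8 fold owner); WHAT IS
REPRODUCED = the CONCRETE side of SKELETON row `B8.Eq1.27` (typed-existing, hitherto ABSTRACT ONLY: carrier field
`B8.GFData.Landau`) and of the Landau clauses of rows `B8.Eq1.36` ((1.38)), `B8.Eq1.40` ((1.42)), `B8.Prop6` ((1.138)),
`B8.Thm8` ((1.146)); it answers the interface need `I-B8-1` of `run/shared/lean/pub/lit-balaban/lit-balaban-r05/INTERFACES-B8.md`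
(«the Landau projection R(U₀) … the projection never needs to be constructed — since R(U₀) is the orthogonal projection ONTO
Δ^η_{U₀}N(Q′(U₀)), "R(U₀)X = 0" ⇔ "⟨X, Δ^η_{U₀}δλ⟩ = 0 for every δλ ∈ N(Q′(U₀))"»).  Kind «definition + kernel-checked
dictionary»; no `… : Prop` fact without arguments is introduced; nothing is asserted about existence or size of solutions
of (1.27) (that is Theorems 2/4/8, rows B8.Thm2/Thm4/Thm8, statement rows).

WHAT IS PRINTED (verbatim).
* p. 80 [PDF 6]: *"Let us recall the definition of this gauge, as it was given in [2, 4]. We consider the subspace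
  N(Q′(U₀)) = {λ : Q′(U₀)λ = 0} of the space L²(Ω₀, 𝔤) of functions on Ω₀ with values in the Lie algebra 𝔤. We assume
  always that U₀ is a sufficiently regular configuration, so that operators depending on U₀ are well defined and all
  necessary properties hold for them. Later we will state precisely the assumptions. An operator R(U₀) is defined as an
  orthogonal projection in this real Hilbert space, onto the subspace Δ^η_{U₀}N(Q′(U₀)). The Landau gauge condition can be
  defined formally on the whole space of gauge field configurations in terms of the variables U′ by the equation
  R(U₀)D^{η*}_{U₀}(1/i) log U′ = 0. (1.27) This definition has a sense really only for configurations in a small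
  neighborhood of U₀, thus for A′ = (1/i) log U′ sufficiently small."*
* p. 82, (1.38): *"R(U₀)D^{η*}_{U₀}A = 0"* (for U₁ = U′^{u⁻¹} = e^{iηA}); p. 83, (1.42): *"R(U₀)D^{η*}_{U₀}A = 0, …"*;
  p. 99, (1.138): *"R∂^{η*}A = 0, the operator R is determined by {□_j}."* (U₀ = 1 on the cube family); p. 101, (1.146):
  *"R(U₀)D^{η*}_{U₀}A = f"*, f *"an arbitrary function … from the space R(U₀)"* (Theorem 8).
* [4] p. 394, (3.20)–(3.21): *"R = R(U) is an orthogonal projection in the Hilbert space L²(Ω₀, 𝔤) onto the subspace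
  R = Δ^η_U N(Q′), N(Q′) = {λ : Q′λ = 0}. (3.21)"*; (3.23): *"Δ^η_U = D^η\*_U D^η_U"*; (3.25): *"Rf = (I − G′Q′\*(Q′G′²Q′\*)^{−1}
  Q′G′)f"* — typed in `B9Eq325Proj` (`lapKer Δ q` = Δ^η_U N(Q′), `R325`, `Data`, `R325_eq_starProjection`) and realised on
  finite lattice carriers in `B9Thm311Lattice` (`lapL` = D†D, `qL` = Q′ of (3.19) with transports R(U(Γ_{y,x})), `DL` = D of
  (3.3); `obvious_311_lattice`: the (3.25) data EXIST for every background with injective transports).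

WHAT THIS MODULE DOES.
§1 ABSTRACT (E ⊇ L²(Ω₀, 𝔤) and F = L²(𝔅) real inner-product spaces, Δ = Δ^η_{U₀}, q = Q′(U₀)):
   `IsLandauBG Δ q X` := «⟨Δλ, X⟩ = 0 for every λ with Q′λ = 0» — the equation «R(U₀)X = 0» in variational form;
   `isLandauBG_iff_mem_orthogonal` (X ∈ (Δ N(Q′))ᗮ), the solution space `landauSpace Δ q = (lapKer Δ q)ᗮ` (a closed
   subspace: `mem_landauSpace_iff`); **`isLandauBG_iff_R325_eq_zero`**: under the printed inputs of [4] (3.23)–(3.25)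
   the variational condition IS «RX = 0» for the (3.25) operator R — PROVED from `R325_symm`/`R325_idem`/`range_R325`
   (no completeness / `HasOrthogonalProjection` hypothesis needed), and `isLandauBG_iff_starProjection_eq_zero` (Mathlib's
   orthogonal projection, when it exists).  The SOURCE form of Theorem 8, (1.146) «R(U₀)D^{η*}_{U₀}A = f», f ∈ R(U₀):
   `IsLandauSrc Δ q f X := f ∈ lapKer Δ q ∧ IsLandauBG Δ q (X − f)`, **`isLandauSrc_iff_R325_eq`** (⇔ RX = f),
   `isLandauSrc_zero_iff` ((1.146) at f = 0 is (1.38)).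
§2 LATTICE (the carriers of `B9Thm311Lattice`: sites `X`, block centres `Y`, fibre `V` = 𝔤 as a real inner-product
   space, transports `τ x x' = R(U₀(⟨x,x'⟩))`, bond set and weights, block system (3.19)): `LandauBGL … X` :=
   `IsLandauBG (lapL τ bonds cb) (qL τ w B Γ y) X` for a SITE function X (= D^{η*}_{U₀}A), and **`Landau138L … A`** :=
   the same for X = D†A, A a 𝔤-valued BOND field — this is (1.38)/(1.42) «R(U₀)D^{η*}_{U₀}A = 0», and (1.27) itself for
   A = A′ = (1/i) log U′ (the logarithmic chart U′ ↦ A′ is the datum here, as on p. 80 "in terms of the variables U′ …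
   for A′ = (1/i) log U′ sufficiently small"; the chart is `B8Eq146AExpansion`/`B7` business); explicit forms
   `landauBGL_iff`, `landau138L_iff` («Σ over N(Q′(U₀)) of ⟨DΔλ, A⟩ = 0»), `landau138L_iff_inner_lap` (⟨Δλ, D†A⟩ = 0);
   **`landauBGL_iff_R325_eq_zero` / `landau138L_iff_R325_eq_zero`**: for EVERY background with injective transports,
   positive bond weights, positive a and every block system, (3.25)-data (G′, (Q′G′²Q′\*)^{−1}) EXIST and the typed
   condition is «RX = 0» for the printed R — so on the lattice the variational typing and the printed operator equation
   are the same statement with no regularity assumption on U₀ (p. 80's "We assume always that U₀ is a sufficiently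
   regular configuration" is needed for the BOUNDS of [4], not for the definition); `landauBGL_iff_starProjection_eq_zero`.
§3 U₀ = 1 / cube family (1.138) «R∂^{η*}A = 0, the operator R is determined by {□_j}»: the instance `τ = id`
   (`Landau138One`), definitionally `Landau138L` at identity transports (`landau138One_iff`); cf. the abelian one-level V1
   form `LatticeFieldCalculus.IsLandauGauge` (r18), which has the same variational shape «∀ δλ, Q′δλ = 0 → Σ_x (Δδλ)(x)
   (∂*A)(x) = 0» on the `Setup` tori (not bridged here: different carriers).

HONEST SCOPE.  (i) Pairing: [4] p. 393 weights the fine scalar product by η^d and (3.24) the blocks by a_j(L^jη)^{d−2};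
`B9Thm311Lattice` uses the unweighted ℓ² of `PiLp 2` with the weights absorbed into c_b, a_c, w (cell DIVERGENCE D-b09.24;
`B9Eq325Pairing.R325_weighted_eq_starProjection` shows R is pairing-invariant) — orthogonality to Δ^η_{U₀}N(Q′) and hence
`IsLandauBG` are unaffected by a constant weight.  (ii) Δ^η_{U₀} here is [4]'s D†D with Dirichlet conditions on Ω₀ᶜ as
modelled by the bond set of `lapL` (`B9Eq322Dirichlet`); Ω₀, 𝔅, Λ_j enter only through the carriers X, Y and the block
system.  (iii) (1.27) is typed on the Lie-algebra side A′; no statement about U′ ↦ (1/i) log U′, about existence or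
uniqueness of the gauge-fixed representative (Theorems 2, 4, 8) or about any bound is made.  (iv) The abstract B8
carrier field `B8.GFData.Landau` (r1) stays the leaf consumed by `B8.Thm2Printed` etc.; this file gives the concrete
predicate a later knitting can feed into `B8Eq119TwistedAxial.Thm4At`'s `Concl` once B8's ℤᵈ/𝔸 carriers
(`B8Ineq132.covDeriv`) are given a real pairing (INTERFACES-B8 I-B8-1, second half) — not done here.  Value = a typed
definition with a kernel-checked dictionary to the printed projection of [4]; NOT summit progress.
-/

namespace Literature.MathematicalPhysics.QuantumFieldTheory.Balaban1983to89.B8Eq127LandauGauge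

open B9Eq325Proj B9Thm311Lattice
open scoped InnerProductSpace

noncomputable section

/-! ## §1  Abstract: «R(U₀)X = 0» ⟺ X ⊥ Δ^η_{U₀}N(Q′(U₀)) -/

section Abstract

variable {E F : Type*} [NormedAddCommGroup E] [InnerProductSpace ℝ E] [NormedAddCommGroup F]
  [InnerProductSpace ℝ F]

/-- **(1.27)/(1.38) in variational form.**  For Δ = Δ^η_{U₀} (covariant Laplacian on L²(Ω₀, 𝔤)) and q = Q′(U₀) (the
linearised averaging, N(Q′(U₀)) = ker q): the site function X (= D^{η*}_{U₀}(1/i) log U′ in (1.27), = D^{η*}_{U₀}A in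
(1.38)/(1.42)) satisfies «R(U₀)X = 0», R(U₀) = the orthogonal projection onto Δ^η_{U₀}N(Q′(U₀)), iff
⟨Δ^η_{U₀}λ, X⟩ = 0 for every λ with Q′(U₀)λ = 0. [cite: Balaban1985RegularSpaces, (1.27) p.80] -/
def IsLandauBG (Δ : E →ₗ[ℝ] E) (q : E →ₗ[ℝ] F) (X : E) : Prop :=
  ∀ l : E, q l = 0 → ⟪Δ l, X⟫_ℝ = 0

variable (Δ : E →ₗ[ℝ] E) (q : E →ₗ[ℝ] F)

/-- unfolding. [cite: Balaban1985RegularSpaces, (1.27) p.80] -/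
theorem isLandauBG_iff (X : E) : IsLandauBG Δ q X ↔ ∀ l : E, q l = 0 → ⟪Δ l, X⟫_ℝ = 0 := Iff.rfl

/-- «R(U₀)X = 0» ⟺ X is orthogonal to every element of the subspace Δ^η_{U₀}N(Q′(U₀)) (= `B9Eq325Proj.lapKer Δ q`, [4]
(3.21)). [cite: Balaban1985RegularSpaces, (1.27) p.80] -/
theorem isLandauBG_iff_forall_mem (X : E) : IsLandauBG Δ q X ↔ ∀ ω ∈ lapKer Δ q, ⟪ω, X⟫_ℝ = 0 := by
  constructor
  · intro h ω hω
    obtain ⟨l, hl, rfl⟩ := (mem_lapKer Δ q ω).mp hω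
    exact h l hl
  · intro h l hl
    exact h (Δ l) ((mem_lapKer Δ q _).mpr ⟨l, hl, rfl⟩)

/-- «R(U₀)X = 0» ⟺ X ∈ (Δ^η_{U₀}N(Q′(U₀)))ᗮ. [cite: Balaban1985RegularSpaces, (1.27) p.80] -/
theorem isLandauBG_iff_mem_orthogonal (X : E) : IsLandauBG Δ q X ↔ X ∈ (lapKer Δ q)ᗮ := by
  rw [isLandauBG_iff_forall_mem, Submodule.mem_orthogonal]

/-- **The Landau subspace** of L²(Ω₀, 𝔤): the solutions X of «R(U₀)X = 0», i.e. (Δ^η_{U₀}N(Q′(U₀)))ᗮ = ker R(U₀) — "the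
surface given by (1.27)" is, in the variable A′, the preimage of this linear subspace under D^{η*}_{U₀}.
[cite: Balaban1985RegularSpaces, (1.27) p.80] -/
def landauSpace : Submodule ℝ E := (lapKer Δ q)ᗮ

/-- membership in the Landau subspace is the Landau condition. [cite: Balaban1985RegularSpaces, (1.27) p.80] -/
theorem mem_landauSpace_iff (X : E) : X ∈ landauSpace Δ q ↔ IsLandauBG Δ q X :=
  (isLandauBG_iff_mem_orthogonal Δ q X).symm

/-- X = 0 satisfies the condition (A′ = 0, i.e. U′ = 1: the background itself is in its own Landau gauge).
[cite: Balaban1985RegularSpaces, (1.27) p.80] -/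
theorem isLandauBG_zero : IsLandauBG Δ q 0 := fun _ _ => inner_zero_right _

/-- the condition is linear in X: sums. [cite: Balaban1985RegularSpaces, (1.27) p.80] -/
theorem IsLandauBG.add {Δ : E →ₗ[ℝ] E} {q : E →ₗ[ℝ] F} {X X' : E} (h : IsLandauBG Δ q X) (h' : IsLandauBG Δ q X') :
    IsLandauBG Δ q (X + X') := fun l hl => by
  rw [inner_add_right, h l hl, h' l hl, add_zero]

/-- the condition is linear in X: scalars. [cite: Balaban1985RegularSpaces, (1.27) p.80] -/
theorem IsLandauBG.smul {Δ : E →ₗ[ℝ] E} {q : E →ₗ[ℝ] F} {X : E} (h : IsLandauBG Δ q X) (r : ℝ) :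
    IsLandauBG Δ q (r • X) := fun l hl => by
  rw [real_inner_smul_right, h l hl, mul_zero]

/-- the condition is linear in X: differences. [cite: Balaban1985RegularSpaces, (1.27) p.80] -/
theorem IsLandauBG.sub {Δ : E →ₗ[ℝ] E} {q : E →ₗ[ℝ] F} {X X' : E} (h : IsLandauBG Δ q X) (h' : IsLandauBG Δ q X') :
    IsLandauBG Δ q (X - X') := fun l hl => by
  rw [inner_sub_right, h l hl, h' l hl, sub_zero]

/-- When the orthogonal projection onto Δ^η_{U₀}N(Q′(U₀)) exists in Mathlib's sense (automatic in finite dimension: the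
lattice spaces), «R(U₀)X = 0» with R(U₀) := that projection IS the typed condition.
[cite: Balaban1985RegularSpaces, (1.27) p.80] -/
theorem isLandauBG_iff_starProjection_eq_zero [(lapKer Δ q).HasOrthogonalProjection] (X : E) :
    IsLandauBG Δ q X ↔ (lapKer Δ q).starProjection X = 0 := by
  rw [isLandauBG_iff_mem_orthogonal, Submodule.starProjection_apply_eq_zero_iff]

/-- **(1.146)** «R(U₀)D^{η*}_{U₀}A = f», f *"from the space R(U₀)"* (Theorem 8, p. 101), in variational form: f lies in
Δ^η_{U₀}N(Q′(U₀)) and X − f ⊥ Δ^η_{U₀}N(Q′(U₀)) (X = D^{η*}_{U₀}A). [cite: Balaban1985RegularSpaces, (1.146) p.101] -/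
def IsLandauSrc (Δ : E →ₗ[ℝ] E) (q : E →ₗ[ℝ] F) (f X : E) : Prop :=
  f ∈ lapKer Δ q ∧ IsLandauBG Δ q (X - f)

/-- (1.146) at f = 0 is (1.38). [cite: Balaban1985RegularSpaces, (1.146) p.101] -/
theorem isLandauSrc_zero_iff (X : E) : IsLandauSrc Δ q 0 X ↔ IsLandauBG Δ q X := by
  simp only [IsLandauSrc, Submodule.zero_mem, true_and, sub_zero]

end Abstract

/-! ### §1b  Under the printed inputs of [4] (3.23)–(3.25): the variational condition IS «RX = 0» for the operator
R = I − G′Q′\*(Q′G′²Q′\*)^{−1}Q′G′ of (3.25) (`B9Eq325Proj.R325`), the printed orthogonal projection -/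

section WithData

variable {E F : Type*} [NormedAddCommGroup E] [InnerProductSpace ℝ E] [NormedAddCommGroup F]
  [InnerProductSpace ℝ F]
variable {Δ : E →ₗ[ℝ] E} {q : E →ₗ[ℝ] F} {qs : F →ₗ[ℝ] E} {A : F →ₗ[ℝ] F} {g : E →ₗ[ℝ] E} {c : F →ₗ[ℝ] F}

/-- **«R(U₀)X = 0» ⟺ the variational Landau condition**, for the (3.25) operator R of [4] built from ANY system of
printed inputs (Δ^η_{U₀} symmetric, Q′\* adjoint to Q′, G′ = (Δ′_a)^{−1}, (Q′G′²Q′\*)^{−1}): R is symmetric, idempotent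
and has range exactly Δ^η_{U₀}N(Q′(U₀)) (`B9Eq325Proj`), so RX = 0 iff X ⊥ that range.  No completeness hypothesis.
[cite: Balaban1985RegularSpaces, (1.27) p.80; Balaban1985BackgroundPropagators, (3.21)+(3.25) p.394] -/
theorem isLandauBG_iff_R325_eq_zero (h : Data Δ q qs A g c) (X : E) : IsLandauBG Δ q X ↔ R325 q qs g c X = 0 := by
  rw [isLandauBG_iff_forall_mem]
  constructor
  · intro hX
    have h1 : ⟪R325 q qs g c X, R325 q qs g c X⟫_ℝ = 0 := by
      rw [h.R325_symm, h.R325_idem, real_inner_comm]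
      exact hX _ (h.R325_mem X)
    exact inner_self_eq_zero.mp h1
  · intro hX ω hω
    have hfix : R325 q qs g c ω = ω := (h.R325_fix_iff_mem ω).mpr hω
    rw [← hfix, h.R325_symm, hX, inner_zero_right]

/-- The Landau subspace is the kernel of the (3.25) operator R. [cite: Balaban1985RegularSpaces, (1.27) p.80] -/
theorem landauSpace_eq_ker (h : Data Δ q qs A g c) : landauSpace Δ q = LinearMap.ker (R325 q qs g c) := by
  ext X
  rw [mem_landauSpace_iff, LinearMap.mem_ker, isLandauBG_iff_R325_eq_zero h]

/-- **(1.146) ⟺ «RX = f»** for the (3.25) operator R. [cite: Balaban1985RegularSpaces, (1.146) p.101] -/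
theorem isLandauSrc_iff_R325_eq (h : Data Δ q qs A g c) (f X : E) : IsLandauSrc Δ q f X ↔ R325 q qs g c X = f := by
  unfold IsLandauSrc
  rw [isLandauBG_iff_R325_eq_zero h, map_sub]
  constructor
  · rintro ⟨hf, hXf⟩
    have hfix : R325 q qs g c f = f := (h.R325_fix_iff_mem f).mpr hf
    rwa [hfix, sub_eq_zero] at hXf
  · intro hX
    have hf : f ∈ lapKer Δ q := hX ▸ h.R325_mem X
    refine ⟨hf, ?_⟩
    rw [(h.R325_fix_iff_mem f).mpr hf, hX, sub_self]

/-- NON-VACUITY / DECOMPOSITION: for every X, the vector X − R(U₀)X satisfies the Landau condition — I − R(U₀) is the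
projection of L²(Ω₀, 𝔤) onto the Landau subspace, so every site function splits as (Landau part) + (element of
Δ^η_{U₀}N(Q′(U₀))). [cite: Balaban1985RegularSpaces, (1.27) p.80] -/
theorem isLandauBG_sub_R325 (h : Data Δ q qs A g c) (X : E) : IsLandauBG Δ q (X - R325 q qs g c X) := by
  rw [isLandauBG_iff_R325_eq_zero h, map_sub, h.R325_idem, sub_self]

/-- Every f "from the space R(U₀)" is attained: X := f + X₀ with X₀ in the Landau subspace solves (1.146) — the source
form is the affine translate of (1.38). [cite: Balaban1985RegularSpaces, (1.146) p.101] -/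
theorem isLandauSrc_add_iff (Δ : E →ₗ[ℝ] E) (q : E →ₗ[ℝ] F) {f : E} (hf : f ∈ lapKer Δ q) (X₀ : E) :
    IsLandauSrc Δ q f (f + X₀) ↔ IsLandauBG Δ q X₀ := by
  simp only [IsLandauSrc, hf, true_and, add_sub_cancel_left]

end WithData

/-! ## §2  On the lattice carriers of [4] (`B9Thm311Lattice`): (1.27)/(1.38) for every background field -/

section Lattice

variable {X : Type*} {Y : Type*} {V : Type*} [NormedAddCommGroup V] [InnerProductSpace ℝ V]
variable [Fintype X] [Fintype Y] [FiniteDimensional ℝ V]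

/-- **«R(U₀)X = 0» on the lattice**, for a 𝔤-valued SITE function X on Ω₀ (E = ℓ²(X, V), V = 𝔤 with its real scalar
product): Δ^η_{U₀} = D†D (`lapL`, transports `τ x x' = R(U₀(⟨x, x'⟩))`, bond weights `cb`), Q′(U₀) = `qL` ((3.19) of [4]:
block system `w, B, Γ, y` with transports along the contours Γ_{y,x}). [cite: Balaban1985RegularSpaces, (1.27) p.80] -/
def LandauBGL (τ : X → X → V →ₗ[ℝ] V) (bonds : Finset (X × X)) (cb : X × X → ℝ) (w : Y → X → ℝ)
    (B : Y → Finset X) (Γ : Y → X → List X) (y : Y → X) (Xf : PiLp 2 (fun _ : X => V)) : Prop :=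
  IsLandauBG (lapL τ bonds cb) (qL τ w B Γ y) Xf

/-- **(1.38)/(1.42) «R(U₀)D^{η*}_{U₀}A = 0» on the lattice** for a 𝔤-valued BOND field A (a vector field; for (1.27)
take A = A′ = (1/i) log U′): X = D†A with D = the covariant derivative (3.3) of [4] (`DL`), D^{η*}_{U₀} = its adjoint
((3.23) of [4]: Δ^η_{U₀} = D^{η*}D^η). [cite: Balaban1985RegularSpaces, (1.38) p.82] -/
def Landau138L (τ : X → X → V →ₗ[ℝ] V) (bonds : Finset (X × X)) (cb : X × X → ℝ) (w : Y → X → ℝ)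
    (B : Y → Finset X) (Γ : Y → X → List X) (y : Y → X) (Af : PiLp 2 (fun _ : ↥bonds => V)) : Prop :=
  LandauBGL τ bonds cb w B Γ y (LinearMap.adjoint (DL τ bonds cb) Af)

variable (τ : X → X → V →ₗ[ℝ] V) (bonds : Finset (X × X)) (cb : X × X → ℝ) (w : Y → X → ℝ)
  (B : Y → Finset X) (Γ : Y → X → List X) (y : Y → X)

/-- unfolding: «⟨Δ^η_{U₀}λ, X⟩ = 0 for all λ with Q′(U₀)λ = 0». [cite: Balaban1985RegularSpaces, (1.27) p.80] -/
theorem landauBGL_iff (Xf : PiLp 2 (fun _ : X => V)) :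
    LandauBGL τ bonds cb w B Γ y Xf ↔
      ∀ l : PiLp 2 (fun _ : X => V), qL τ w B Γ y l = 0 → ⟪lapL τ bonds cb l, Xf⟫_ℝ = 0 := Iff.rfl

/-- the same with the quadratic form of (3.23) opened: «⟨Dλ, DX⟩ = 0», i.e. Σ_b c_b ⟨(D_{U₀}λ)(b), (D_{U₀}X)(b)⟩ = 0 for
all λ ∈ N(Q′(U₀)). [cite: Balaban1985RegularSpaces, (1.27) p.80] -/
theorem landauBGL_iff_inner_DL (Xf : PiLp 2 (fun _ : X => V)) :
    LandauBGL τ bonds cb w B Γ y Xf ↔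
      ∀ l : PiLp 2 (fun _ : X => V), qL τ w B Γ y l = 0 → ⟪DL τ bonds cb l, DL τ bonds cb Xf⟫_ℝ = 0 := by
  simp only [landauBGL_iff, inner_lapL_left]

/-- (1.38) unfolded: «⟨Δ^η_{U₀}λ, D^{η*}_{U₀}A⟩ = 0 for all λ ∈ N(Q′(U₀))». [cite: Balaban1985RegularSpaces, (1.38) p.82] -/
theorem landau138L_iff_inner_lap (Af : PiLp 2 (fun _ : ↥bonds => V)) :
    Landau138L τ bonds cb w B Γ y Af ↔
      ∀ l : PiLp 2 (fun _ : X => V), qL τ w B Γ y l = 0 →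
        ⟪lapL τ bonds cb l, LinearMap.adjoint (DL τ bonds cb) Af⟫_ℝ = 0 := Iff.rfl

/-- (1.38) with the adjoint moved: «⟨D^η_{U₀}Δ^η_{U₀}λ, A⟩ = 0 for all λ ∈ N(Q′(U₀))» — the bond-field form.
[cite: Balaban1985RegularSpaces, (1.38) p.82] -/
theorem landau138L_iff (Af : PiLp 2 (fun _ : ↥bonds => V)) :
    Landau138L τ bonds cb w B Γ y Af ↔
      ∀ l : PiLp 2 (fun _ : X => V), qL τ w B Γ y l = 0 → ⟪DL τ bonds cb (lapL τ bonds cb l), Af⟫_ℝ = 0 := by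
  simp only [landau138L_iff_inner_lap, LinearMap.adjoint_inner_right]

/-- «R(U₀)X = 0» with R(U₀) := Mathlib's orthogonal projection onto Δ^η_{U₀}N(Q′(U₀)) (finite dimension).
[cite: Balaban1985RegularSpaces, (1.27) p.80] -/
theorem landauBGL_iff_starProjection_eq_zero (Xf : PiLp 2 (fun _ : X => V)) :
    LandauBGL τ bonds cb w B Γ y Xf ↔
      (lapKer (lapL τ bonds cb) (qL τ w B Γ y)).starProjection Xf = 0 :=
  isLandauBG_iff_starProjection_eq_zero _ _ Xf

/-- For ANY system of (3.25)-data over the lattice operators, the typed condition is «RX = 0» for the printed R.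
[cite: Balaban1985RegularSpaces, (1.27) p.80; Balaban1985BackgroundPropagators, (3.25) p.394] -/
theorem landauBGL_iff_R325_eq_zero_of_data {a : Y → ℝ}
    {g : PiLp 2 (fun _ : X => V) →ₗ[ℝ] PiLp 2 (fun _ : X => V)}
    {c : PiLp 2 (fun _ : Y => V) →ₗ[ℝ] PiLp 2 (fun _ : Y => V)}
    (h : Data (lapL τ bonds cb) (qL τ w B Γ y) (LinearMap.adjoint (qL τ w B Γ y)) (AL a) g c)
    (Xf : PiLp 2 (fun _ : X => V)) :
    LandauBGL τ bonds cb w B Γ y Xf ↔ R325 (qL τ w B Γ y) (LinearMap.adjoint (qL τ w B Γ y)) g c Xf = 0 :=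
  isLandauBG_iff_R325_eq_zero h Xf

/-- **(1.27)/(1.38) on the lattice = «RX = 0» for the PRINTED projection, for EVERY background field**: with injective
transports (conjugations R(U₀(b)) are), positive bond weights, positive averaging weights a and any block system with
the printed structural properties, the (3.25)-data G′ = (Δ′_a)^{−1}, (Q′G′²Q′\*)^{−1} of [4] EXIST (`obvious_311_lattice`,
Theorem 3.11 "obvious" clause) and the typed variational condition is equivalent to RX = 0 — no "sufficiently regular
U₀" is needed for the DEFINITION. [cite: Balaban1985RegularSpaces, (1.27) p.80; Balaban1985BackgroundPropagators, Thm 3.11 p.416] -/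
theorem landauBGL_iff_R325_eq_zero (hinj : ∀ x x' : X, Function.Injective (τ x x'))
    (hcb : ∀ b ∈ bonds, 0 < cb b) (hS : IsBlockSystem bonds w B Γ y) (a : Y → ℝ) (ha : ∀ c, 0 < a c) :
    ∃ (g : PiLp 2 (fun _ : X => V) →ₗ[ℝ] PiLp 2 (fun _ : X => V))
      (c : PiLp 2 (fun _ : Y => V) →ₗ[ℝ] PiLp 2 (fun _ : Y => V)),
      Data (lapL τ bonds cb) (qL τ w B Γ y) (LinearMap.adjoint (qL τ w B Γ y)) (AL a) g c ∧
        ∀ Xf : PiLp 2 (fun _ : X => V),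
          (LandauBGL τ bonds cb w B Γ y Xf ↔
            R325 (qL τ w B Γ y) (LinearMap.adjoint (qL τ w B Γ y)) g c Xf = 0) := by
  obtain ⟨g, c, hdata, -, -, -, -, -⟩ := obvious_311_lattice τ hinj cb hcb hS a ha
  exact ⟨g, c, hdata, fun Xf => isLandauBG_iff_R325_eq_zero hdata Xf⟩

/-- (1.38) for the bond field: the same equivalence with X = D†A.
[cite: Balaban1985RegularSpaces, (1.38) p.82; Balaban1985BackgroundPropagators, Thm 3.11 p.416] -/
theorem landau138L_iff_R325_eq_zero (hinj : ∀ x x' : X, Function.Injective (τ x x'))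
    (hcb : ∀ b ∈ bonds, 0 < cb b) (hS : IsBlockSystem bonds w B Γ y) (a : Y → ℝ) (ha : ∀ c, 0 < a c) :
    ∃ (g : PiLp 2 (fun _ : X => V) →ₗ[ℝ] PiLp 2 (fun _ : X => V))
      (c : PiLp 2 (fun _ : Y => V) →ₗ[ℝ] PiLp 2 (fun _ : Y => V)),
      Data (lapL τ bonds cb) (qL τ w B Γ y) (LinearMap.adjoint (qL τ w B Γ y)) (AL a) g c ∧
        ∀ Af : PiLp 2 (fun _ : ↥bonds => V),
          (Landau138L τ bonds cb w B Γ y Af ↔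
            R325 (qL τ w B Γ y) (LinearMap.adjoint (qL τ w B Γ y)) g c
              (LinearMap.adjoint (DL τ bonds cb) Af) = 0) := by
  obtain ⟨g, c, hdata, h⟩ := landauBGL_iff_R325_eq_zero τ bonds cb w B Γ y hinj hcb hS a ha
  exact ⟨g, c, hdata, fun Af => h _⟩

/-- **(1.146) on the lattice** «R(U₀)D^{η*}_{U₀}A = f» (Theorem 8's source form), f ∈ R(U₀) = Δ^η_{U₀}N(Q′(U₀)).
[cite: Balaban1985RegularSpaces, (1.146) p.101] -/
def Landau146L (f : PiLp 2 (fun _ : X => V)) (Af : PiLp 2 (fun _ : ↥bonds => V)) : Prop :=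
  IsLandauSrc (lapL τ bonds cb) (qL τ w B Γ y) f (LinearMap.adjoint (DL τ bonds cb) Af)

/-- (1.146) at f = 0 is (1.38). [cite: Balaban1985RegularSpaces, (1.146) p.101] -/
theorem landau146L_zero_iff (Af : PiLp 2 (fun _ : ↥bonds => V)) :
    Landau146L τ bonds cb w B Γ y 0 Af ↔ Landau138L τ bonds cb w B Γ y Af :=
  isLandauSrc_zero_iff _ _ _

/-- (1.146) on the lattice is «R D†A = f» for the printed R, for every background (data as in
`landauBGL_iff_R325_eq_zero`). [cite: Balaban1985RegularSpaces, (1.146) p.101; Balaban1985BackgroundPropagators, Thm 3.11 p.416] -/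
theorem landau146L_iff_R325_eq (hinj : ∀ x x' : X, Function.Injective (τ x x'))
    (hcb : ∀ b ∈ bonds, 0 < cb b) (hS : IsBlockSystem bonds w B Γ y) (a : Y → ℝ) (ha : ∀ c, 0 < a c) :
    ∃ (g : PiLp 2 (fun _ : X => V) →ₗ[ℝ] PiLp 2 (fun _ : X => V))
      (c : PiLp 2 (fun _ : Y => V) →ₗ[ℝ] PiLp 2 (fun _ : Y => V)),
      Data (lapL τ bonds cb) (qL τ w B Γ y) (LinearMap.adjoint (qL τ w B Γ y)) (AL a) g c ∧
        ∀ (f : PiLp 2 (fun _ : X => V)) (Af : PiLp 2 (fun _ : ↥bonds => V)),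
          (Landau146L τ bonds cb w B Γ y f Af ↔
            R325 (qL τ w B Γ y) (LinearMap.adjoint (qL τ w B Γ y)) g c
              (LinearMap.adjoint (DL τ bonds cb) Af) = f) := by
  obtain ⟨g, c, hdata, -, -, -, -, -⟩ := obvious_311_lattice τ hinj cb hcb hS a ha
  exact ⟨g, c, hdata, fun f Af => isLandauSrc_iff_R325_eq hdata f _⟩

end Lattice

/-! ## §3  U₀ = 1: (1.138) «R∂^{η*}A = 0, the operator R is determined by {□_j}» (identity transports) -/

section Flat

variable {X : Type*} {Y : Type*} {V : Type*} [NormedAddCommGroup V] [InnerProductSpace ℝ V]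

/-- identity transports: the background U₀ = 1 (R(1) = id on 𝔤). [cite: Balaban1985RegularSpaces, (1.138) p.99] -/
def idTransport (X V : Type*) [AddCommGroup V] [Module ℝ V] : X → X → V →ₗ[ℝ] V := fun _ _ => LinearMap.id

/-- identity transports are injective (so `landauBGL_iff_R325_eq_zero` applies at U₀ = 1).
[cite: Balaban1985RegularSpaces, (1.138) p.99] -/
theorem idTransport_injective (x x' : X) : Function.Injective (idTransport X V x x') := fun _ _ h => h

/-- at U₀ = 1 the covariant difference (3.3) is the plain difference ∂: (Dλ)(⟨x, x'⟩) = λ(x') − λ(x).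
[cite: Balaban1985RegularSpaces, (1.138) p.99] -/
theorem covD_idTransport (l : X → V) (x x' : X) : B9Eq323Ker.covD (idTransport X V) l x x' = l x' - l x := rfl

variable [Fintype X] [Fintype Y] [FiniteDimensional ℝ V]

/-- **(1.138) «R∂^{η*}A = 0, the operator R is determined by {□_j}»**: the Landau condition of Proposition 6 for the flat
background U₀ = 1 on the cube family — (1.38) at identity transports, the block system being that of the cubes {□_j}
(supplied as the datum `w, B, Γ, y`). [cite: Balaban1985RegularSpaces, (1.138) p.99] -/
def Landau138One (bonds : Finset (X × X)) (cb : X × X → ℝ) (w : Y → X → ℝ) (B : Y → Finset X)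
    (Γ : Y → X → List X) (y : Y → X) (Af : PiLp 2 (fun _ : ↥bonds => V)) : Prop :=
  Landau138L (idTransport X V) bonds cb w B Γ y Af

/-- (1.138) is (1.38) at U₀ = 1 (definitional). [cite: Balaban1985RegularSpaces, (1.138) p.99] -/
theorem landau138One_iff (bonds : Finset (X × X)) (cb : X × X → ℝ) (w : Y → X → ℝ) (B : Y → Finset X)
    (Γ : Y → X → List X) (y : Y → X) (Af : PiLp 2 (fun _ : ↥bonds => V)) :
    Landau138One bonds cb w B Γ y Af ↔ Landau138L (idTransport X V) bonds cb w B Γ y Af := Iff.rfl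

/-- (1.138) on the cube family is «R∂†A = 0» for the printed R with U₀ = 1, for every positive weights and block system
(identity transports are injective). [cite: Balaban1985RegularSpaces, (1.138) p.99; Balaban1985BackgroundPropagators, Thm 3.11 p.416] -/
theorem landau138One_iff_R325_eq_zero (bonds : Finset (X × X)) (cb : X × X → ℝ) (hcb : ∀ b ∈ bonds, 0 < cb b)
    {w : Y → X → ℝ} {B : Y → Finset X} {Γ : Y → X → List X} {y : Y → X} (hS : IsBlockSystem bonds w B Γ y)
    (a : Y → ℝ) (ha : ∀ c, 0 < a c) :
    ∃ (g : PiLp 2 (fun _ : X => V) →ₗ[ℝ] PiLp 2 (fun _ : X => V))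
      (c : PiLp 2 (fun _ : Y => V) →ₗ[ℝ] PiLp 2 (fun _ : Y => V)),
      Data (lapL (idTransport X V) bonds cb) (qL (idTransport X V) w B Γ y)
          (LinearMap.adjoint (qL (idTransport X V) w B Γ y)) (AL a) g c ∧
        ∀ Af : PiLp 2 (fun _ : ↥bonds => V),
          (Landau138One bonds cb w B Γ y Af ↔
            R325 (qL (idTransport X V) w B Γ y) (LinearMap.adjoint (qL (idTransport X V) w B Γ y)) g c
              (LinearMap.adjoint (DL (idTransport X V) bonds cb) Af) = 0) :=
  landau138L_iff_R325_eq_zero (idTransport X V) bonds cb w B Γ y idTransport_injective hcb hS a ha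

end Flat

end

end Literature.MathematicalPhysics.QuantumFieldTheory.Balaban1983to89.B8Eq127LandauGauge
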